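/-
Origin: expansion seat `prover-pub-hodgecm-mc-binder-1-0`, handover #6 2026-08-18T18:53Z md5 fd9ee91abeed91271ffe24875e0957d2 (NEW, 612 l. = v3 fd9ee91abeed, supersedes the never-installed v1 c7578506 / v2 9d171ec7; rewrites import McB1.IchinoFockKTypes -> HodgeCM.Literature.IchinoFockKTypes x1, import McB1.TorusScaling -> HodgeCM.Model.Binders.TorusScaling x1; also imports tree HodgeCM.PerL34.FockKTypes; audited names: HodgeCM.Model.Binders.IchinoExplicitLine.lem (`HOME/mc/pub-hodgecm-mc-binder-1/lean/McB1/IchinoExplicitLine.lean`, md5 fd9ee91a, 612 lines);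
landed by the packager successor (mc-unitary-1-g3, gen-8 kit) in gate run 32 as `HodgeCM/Model/Binders/IchinoExplicitLine.lean` (import ^import McB1\.IchinoFockKTypes[ \t]*$→import HodgeCM.Literature.IchinoFockKTypes ×1; import ^import McB1\.TorusScaling[ \t]*$→import HodgeCM.Model.Binders.TorusScaling ×1).
-/
/-
Copyright (c) 2026 the pub-hodgecm formalisation cell (harness21).  New file, not vendored.
Origin: HOME/mc/pub-hodgecm-mc-binder-1/lean/McB1/IchinoExplicitLine.lean — session prover-pub-hodgecm-mc-binder-1-0
(unit pub-hodgecm-mc-binder-1, MODEL-CONSTRUCTION sub-cell, BINDER PROVER hbr/hQ/hch; MODEL-DAG node W3-K).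
Intended final place: `HodgeCM/Model/Binders/IchinoExplicitLine.lean`.  Imports: the LANDED `HodgeCM.PerL34.FockKTypes`
(pv12, run 20) and TWO rewrites `McB1.IchinoFockKTypes` ↦ `HodgeCM.Literature.IchinoFockKTypes`, `McB1.TorusScaling` ↦
`HodgeCM.Model.Binders.TorusScaling`.
KIND: KERNEL — a cited lemma ([Ich22] Lemma 7.10) is PROVED, not cited, for the package's explicit Fock model of the
pair `(U(1), U(2,1))`; nothing of PerL / QW8 / the 2001 programme is used.
-/
import Summits.HodgeConjecture.HodgeCM.PerL34.FockKTypes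
import Summits.HodgeConjecture.HodgeCM.Literature.IchinoFockKTypes
import Summits.HodgeConjecture.HodgeCM.Model.Binders.TorusScaling

set_option autoImplicit false

/-!
# W3-K, first file: Ichino's Lemma 7.10 HOLDS in the explicit Fock model `ℂ[z₁, z₂, w]` of `(U(1), U(2,1))`

`HodgeCM.Literature.IchinoFockKTypes` types [Ich22] = A. Ichino, Adv. Math. 398 (2022) 108188, §7.5 Lemma 7.10 as a
PREDICATE `FockHarmonics.Lemma_7_10` on a dictionary (`corresponds μ μ′` = "`μ ⊠ μ′` occurs in the joint harmonics
`ℋ` of the Fock model of `ω_{V,W,χ_V,χ_W,ψ}`").  For the signature `(p,q;r,s) = (1,0;2,1)` — a hermitian LINE at the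
place `ι₁` against `G_U ≅ U(2,1)`, the case that carries the holomorphic theta one-forms (`𝔭₊`, `J⁺`) — the package
HAS the Fock model as an explicit object: pv12's `HodgeCM.PerL34.Fock.HarmModel = ℂ[z₁, z₂, w]` (`FockKTypes.lean`,
run 20) with the polynomial weight operators `weightOp uWt` (`U(W) = U(1)`: `z_a ↦ +1`, `w ↦ −1`),
`weightOp (hrowWt a)` (the `U(2)_V`-torus), `weightOp hwWt` (the `w`-degree; `U(1)_V` acts by `−1 −` it), the
`𝔲(2)_V` raising operator `hEplus = z₁ ∂_{z₂}`, and (pv14 `P43_KTypesFock.fockRep`) the `K_V`-GROUP action.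

This file ADDS the two printed `𝔭′⁻`-operators of `𝔲(2,1)_ℂ` in this model, `Δ_a = ∂_{z_a} ∂_w` (`a = 1, 2`) — [Ad07]
J. Adams, *The theta correspondence over ℝ* (2007) §4: "`𝔭⁻` acts by second-order constant-coefficient
differential operators", made explicit for this pair by pv12-g7 (`FockPrintLocalPlane.fockOp_rho_plV`:
`ρ(E_{wa} ⊗ 1) = iλ Σ_j ∂_{z_{aj}} ∂_{w_j}`; one column `j` here; the non-zero scalar `iλ` does not change the kernel)
— DEFINES the joint harmonics `ℋ = ker Δ₁ ∩ ker Δ₂` ([Ad07] Def 6.1: `𝓗(K) = {P ∈ 𝓕 | X·P = 0 ∀ X ∈ 𝔭′⁻}`), and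
PROVES:

* `isHarmonic_iff_support` — `f ∈ ℋ` iff every monomial of `f` is a pure `z`-monomial or a pure power of `w`
  (`ℋ = ℂ[z₁,z₂] + w·ℂ[w]`);
* `isHWVector_iff` — the joint `K × K′`-highest-weight vectors in `ℋ` (common eigenvectors of the four weight
  operators, killed by `hEplus`, non-zero) are EXACTLY `c·z₁^a` (`a ≥ 0`; weights `U(1)_W = a`, rows `(a,0)`,
  `w`-degree `0`) and `c·w^d` (`d ≥ 1`; weights `−d`, `(0,0)`, `d`);
* `explicitLine S` — the `FockHarmonics S` dictionary of the explicit model for ANY datum `S` with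
  `(p,q;r,s) = (1,0;2,1)` (the splitting exponents `m₀, n₀` of §4.1 enter as the printed SHIFTS
  `(r−s)/2 + m₀/2 = (1+m₀)/2` on `U(W)`, `((p−q)/2; (q−p)/2) + n₀/2 = ((1+n₀)/2; (n₀−1)/2)` on `K′ = U(2) × U(1)`,
  added to the polynomial weights — the explicit model is the RELATIVE (vacuum-normalised) Fock model, so one
  instance serves every gauge; PerL's gauge is `n₀ = −1`, vacuum `(0,0;−1)`, pv14 `fockRep`'s `d̄`);
* **`lemma_7_10_explicitLine : (explicitLine S …).Lemma_7_10`** — Ichino's Lemma 7.10 is a THEOREM for this model: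
  the corresponding pairs are exactly `(P.mu, P.mu′)` for the parameters `P` of the lemma (here: the vacuum,
  `p⁺ = 1` with `a₁ = a ≥ 1`, `p⁻ = 1` with `b₁ = −d ≤ −1`).

Consequence for the census (MODEL-DAG B1/W3, BINDER-TRIAGE §7.3, GAPS mcb1-X1): at `ι₁` for a LINE the [Ich22] row
of MODEL-N is DISCHARGED on the explicit model; what the archimedean construction W3-B must still supply is only the
identification "the `(𝔤,K)`-module of the constructed `ω_{W_i,ι₁}` is THIS polynomial model with THESE operators"
(Bargmann transform + Adams's printed operators), with no weight parameter left to match.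

References: [Ich22] §4.1, §7.5 L7.10 (typed in `HodgeCM.Literature.IchinoFockKTypes`); [Ad07] §4, Def 6.1, Thm 6.3
(typed in `HodgeCM.Literature.CohomologicalIsolation`, `CompactDualPairFock`).  Nothing is cited AS A HYPOTHESIS here.
-/

noncomputable section

namespace HodgeCM
namespace Model
namespace Binders
namespace IchinoExplicitLine

open MvPolynomial Finsupp
open HodgeCM.PerL34.Fock
open HodgeCM.Literature.Ichino2022 HodgeCM.Literature.Ichino2022.FockHarmonics
  HodgeCM.Literature.Ichino2022.HarmonicParam

/-! ## §0 Weights of monomials in `ℂ[z₁, z₂, w]` (pv12's private lemmas, restated) -/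

/-- (Ported verbatim from the HodgeCMPerL package; no docstring in the source.) -/
theorem wt_uWt (m : HarmVar →₀ ℕ) :
    wt uWt m = (m (Sum.inl 0) : ℤ) + m (Sum.inl 1) - m (Sum.inr ()) := by
  simp only [wt, uWt, Fintype.sum_sum_type, Fin.sum_univ_two, Fintype.sum_unique]
  ring

/-- (Ported verbatim from the HodgeCMPerL package; no docstring in the source.) -/
theorem wt_hrowWt (a : Fin 2) (m : HarmVar →₀ ℕ) : wt (hrowWt a) m = (m (Sum.inl a) : ℤ) := by
  simp only [wt, hrowWt, Fintype.sum_sum_type, Fin.sum_univ_two, Fintype.sum_unique]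
  fin_cases a <;> simp

/-- (Ported verbatim from the HodgeCMPerL package; no docstring in the source.) -/
theorem wt_hwWt (m : HarmVar →₀ ℕ) : wt hwWt m = (m (Sum.inr ()) : ℤ) := by
  simp only [wt, hwWt, Fintype.sum_sum_type, Fin.sum_univ_two, Fintype.sum_unique]
  ring

/-- Extensionality for exponent vectors on the three variables `z₁, z₂, w`. -/
theorem harmVar_ext {m m' : HarmVar →₀ ℕ} (h0 : m (Sum.inl 0) = m' (Sum.inl 0))
    (h1 : m (Sum.inl 1) = m' (Sum.inl 1)) (h2 : m (Sum.inr ()) = m' (Sum.inr ())) : m = m' := by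
  ext v
  rcases v with ⟨i, hi⟩ | u
  · interval_cases i
    · exact h0
    · exact h1
  · obtain ⟨⟩ := u
    exact h2

/-! ## §1 The printed `𝔭′⁻`-operators and the joint harmonics -/

/-- **`Δ_a = ∂_{z_a} ∂_w`** (`a ∈ Fin 2`): the two `𝔭′⁻`-operators of `𝔲(2,1)_ℂ` on the line model, up to the
non-zero scalar `iλ` of [Ad07] §4 / pv12-g7 `fockOp_rho_plV`. -/
def Delta (a : Fin 2) : HarmModel →ₗ[ℂ] HarmModel where
  toFun f := pderiv (Sum.inl a) (pderiv (Sum.inr ()) f)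
  map_add' f g := by simp only [map_add]
  map_smul' r f := by simp only [Derivation.map_smul, RingHom.id_apply]

/-- (Ported verbatim from the HodgeCMPerL package; no docstring in the source.) -/
theorem Delta_apply (a : Fin 2) (f : HarmModel) : Delta a f = pderiv (Sum.inl a) (pderiv (Sum.inr ()) f) := rfl

/-- **The joint harmonics** `ℋ := {f : Δ₁ f = Δ₂ f = 0}` ([Ad07] Def 6.1 for the pair `(U(1), U(2,1))`). -/
def IsHarmonic (f : HarmModel) : Prop := ∀ a : Fin 2, Delta a f = 0

/-- Coefficients of `Δ_a f`. -/
theorem coeff_Delta (a : Fin 2) (f : HarmModel) (m : HarmVar →₀ ℕ) :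
    coeff m (Delta a f) =
      coeff (m + single (Sum.inl a) 1 + single (Sum.inr ()) 1) f *
        (((m (Sum.inr ()) : ℂ) + 1) * ((m (Sum.inl a) : ℂ) + 1)) := by
  rw [Delta_apply, coeff_pderiv, coeff_pderiv]
  have h1 : (m + single (Sum.inl a) 1 : HarmVar →₀ ℕ) (Sum.inr ()) = m (Sum.inr ()) := by
    rw [Finsupp.add_apply, single_apply, if_neg (by simp), add_zero]
  rw [h1]
  ring

/-- `ℋ = ℂ[z₁,z₂] + w ℂ[w]`: `f` is harmonic iff no monomial of `f` involves `w` together with some `z_a`. -/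
theorem isHarmonic_iff_support (f : HarmModel) :
    IsHarmonic f ↔ ∀ m ∈ f.support, m (Sum.inr ()) = 0 ∨ (m (Sum.inl 0) = 0 ∧ m (Sum.inl 1) = 0) := by
  classical
  constructor
  · intro h m hm
    -- if `w` and some `z_a` both occur in `m`, the coefficient of `m − z_a − w` in `Δ_a f` is non-zero
    have key : ∀ a : Fin 2, m (Sum.inl a) ≠ 0 → m (Sum.inr ()) ≠ 0 → False := by
      intro a ha hw
      have hle : single (Sum.inl a) 1 + single (Sum.inr ()) 1 ≤ m := by
        intro v
        rw [Finsupp.add_apply, single_apply, single_apply]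
        split_ifs with h₁ h₂ h₂
        · exact absurd (h₁.trans h₂.symm) Sum.inl_ne_inr
        · subst h₁; omega
        · subst h₂; omega
        · exact Nat.zero_le _
      set m' := m - (single (Sum.inl a) 1 + single (Sum.inr ()) 1) with hm'_def
      have hm' : m' + single (Sum.inl a) 1 + single (Sum.inr ()) 1 = m := by
        rw [add_assoc, hm'_def, tsub_add_cancel_of_le hle]
      have hc : coeff m' (Delta a f) = 0 := by rw [h a, coeff_zero]
      rw [coeff_Delta, hm'] at hc
      rcases mul_eq_zero.mp hc with h1 | h2
      · exact (MvPolynomial.mem_support_iff.mp hm) h1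
      · rcases mul_eq_zero.mp h2 with h3 | h3
        · exact Nat.cast_add_one_ne_zero _ h3
        · exact Nat.cast_add_one_ne_zero _ h3
    by_cases hw : m (Sum.inr ()) = 0
    · exact Or.inl hw
    · by_cases h0 : m (Sum.inl 0) = 0
      · by_cases h1 : m (Sum.inl 1) = 0
        · exact Or.inr ⟨h0, h1⟩
        · exact (key 1 h1 hw).elim
      · exact (key 0 h0 hw).elim
  · intro h a
    ext m
    rw [coeff_Delta, coeff_zero]
    have : coeff (m + single (Sum.inl a) 1 + single (Sum.inr ()) 1) f = 0 := by
      by_contra hne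
      have hm := h _ (MvPolynomial.mem_support_iff.mpr hne)
      simp only [Finsupp.add_apply, single_apply] at hm
      rcases hm with hw | ⟨h0, h1⟩
      · simp at hw
      · fin_cases a
        · simp at h0
        · simp at h1
    rw [this, zero_mul]

/-! ## §2 Joint highest-weight vectors in `ℋ` and their classification -/

/-- **A joint `K × K′`-highest-weight vector in the harmonics** with weights: `U(W) = U(1)`-weight `k`, `U(2)_V`-row
weights `(n₁, n₂)`, `w`-degree `e` (so relative `U(1)_V`-weight `−e`), killed by the raising operator `E₊ = z₁∂_{z₂}`. -/
structure IsHWVector (f : HarmModel) (k n₁ n₂ e : ℤ) : Prop where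
  ne : f ≠ 0
  harm : IsHarmonic f
  uW : weightOp uWt f = (k : ℂ) • f
  row0 : weightOp (hrowWt 0) f = (n₁ : ℂ) • f
  row1 : weightOp (hrowWt 1) f = (n₂ : ℂ) • f
  wdeg : weightOp hwWt f = (e : ℂ) • f
  hw : hEplus f = 0

/-- The exponent vector `(n₁, n₂, e)` of `z₁^{n₁} z₂^{n₂} w^{e}`. -/
def expo (n₁ n₂ e : ℕ) : HarmVar →₀ ℕ :=
  single (Sum.inl 0) n₁ + single (Sum.inl 1) n₂ + single (Sum.inr ()) e

/-- (Ported verbatim from the HodgeCMPerL package; no docstring in the source.) -/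
@[simp] theorem expo_inl0 (n₁ n₂ e : ℕ) : expo n₁ n₂ e (Sum.inl 0) = n₁ := by simp [expo]
/-- (Ported verbatim from the HodgeCMPerL package; no docstring in the source.) -/
@[simp] theorem expo_inl1 (n₁ n₂ e : ℕ) : expo n₁ n₂ e (Sum.inl 1) = n₂ := by simp [expo]
/-- (Ported verbatim from the HodgeCMPerL package; no docstring in the source.) -/
@[simp] theorem expo_inr (n₁ n₂ e : ℕ) : expo n₁ n₂ e (Sum.inr ()) = e := by simp [expo]

/-- (Ported verbatim from the HodgeCMPerL package; no docstring in the source.) -/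
theorem hz0_pow_eq (a : ℕ) : hz 0 ^ a = monomial (expo a 0 0) 1 := by
  rw [hz, X_pow_eq_monomial, expo]; simp

/-- (Ported verbatim from the HodgeCMPerL package; no docstring in the source.) -/
theorem hw_pow_eq (d : ℕ) : hw ^ d = monomial (expo 0 0 d) 1 := by
  rw [hw, X_pow_eq_monomial, expo]; simp

/-- A joint weight vector with weights `(n₁, n₂, e)` is a multiple of the monomial `z₁^{n₁} z₂^{n₂} w^e`. -/
theorem eq_smul_monomial_of_weights {f : HarmModel} {n₁ n₂ e : ℤ}
    (h0 : weightOp (hrowWt 0) f = (n₁ : ℂ) • f) (h1 : weightOp (hrowWt 1) f = (n₂ : ℂ) • f)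
    (he : weightOp hwWt f = (e : ℂ) • f) (hf : f ≠ 0) :
    0 ≤ n₁ ∧ 0 ≤ n₂ ∧ 0 ≤ e ∧
      f = coeff (expo n₁.toNat n₂.toNat e.toNat) f • monomial (expo n₁.toNat n₂.toNat e.toNat) 1 := by
  classical
  -- every monomial in the support has exponents (n₁, n₂, e)
  have key : ∀ m ∈ f.support, (m (Sum.inl 0) : ℤ) = n₁ ∧ (m (Sum.inl 1) : ℤ) = n₂ ∧ (m (Sum.inr ()) : ℤ) = e := by
    intro m hm
    refine ⟨?_, ?_, ?_⟩
    · have := wt_eq_of_weightOp_eq_smul h0 hm; rwa [wt_hrowWt] at this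
    · have := wt_eq_of_weightOp_eq_smul h1 hm; rwa [wt_hrowWt] at this
    · have := wt_eq_of_weightOp_eq_smul he hm; rwa [wt_hwWt] at this
  obtain ⟨m₀, hm₀⟩ : ∃ m, m ∈ f.support := by
    by_contra hno
    apply hf
    ext m
    rw [coeff_zero]
    by_contra hne
    exact hno ⟨m, MvPolynomial.mem_support_iff.mpr hne⟩
  obtain ⟨k0, k1, k2⟩ := key m₀ hm₀
  refine ⟨by omega, by omega, by omega, ?_⟩
  have hM : ∀ m ∈ f.support, m = expo n₁.toNat n₂.toNat e.toNat := by
    intro m hm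
    obtain ⟨j0, j1, j2⟩ := key m hm
    refine harmVar_ext ?_ ?_ ?_
    · rw [expo_inl0]; omega
    · rw [expo_inl1]; omega
    · rw [expo_inr]; omega
  ext m
  rw [coeff_smul, coeff_monomial, smul_eq_mul]
  by_cases hm : expo n₁.toNat n₂.toNat e.toNat = m
  · rw [if_pos hm, mul_one, hm]
  · rw [if_neg hm, mul_zero]
    by_contra hne
    exact hm (hM m (MvPolynomial.mem_support_iff.mpr hne)).symm

/-- `E₊ = z₁ ∂_{z₂}` on a monomial vanishes iff `z₂` does not occur. -/
theorem hEplus_monomial_eq_zero_iff (m : HarmVar →₀ ℕ) (c : ℂ) (hc : c ≠ 0) :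
    hEplus (monomial m c) = 0 ↔ m (Sum.inl 1) = 0 := by
  classical
  have happ : hEplus (monomial m c) = hz 0 * pderiv (Sum.inl 1) (monomial m c) := rfl
  rw [happ, mul_eq_zero, pderiv_monomial]
  constructor
  · rintro (h | h)
    · exact absurd h (X_ne_zero _)
    · rw [monomial_eq_zero] at h
      rcases mul_eq_zero.mp h with h' | h'
      · exact absurd h' hc
      · exact_mod_cast h'
  · intro h
    right
    rw [h]; simp

/-- Weights of a monomial: the four weight operators act on `monomial m c` by the expected integers. -/
theorem weightOp_monomial_expo (n₁ n₂ e : ℕ) (c : ℂ) :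
    weightOp uWt (monomial (expo n₁ n₂ e) c) = (((n₁ : ℤ) + n₂ - e : ℤ) : ℂ) • monomial (expo n₁ n₂ e) c ∧
    weightOp (hrowWt 0) (monomial (expo n₁ n₂ e) c) = ((n₁ : ℤ) : ℂ) • monomial (expo n₁ n₂ e) c ∧
    weightOp (hrowWt 1) (monomial (expo n₁ n₂ e) c) = ((n₂ : ℤ) : ℂ) • monomial (expo n₁ n₂ e) c ∧
    weightOp hwWt (monomial (expo n₁ n₂ e) c) = ((e : ℤ) : ℂ) • monomial (expo n₁ n₂ e) c := by
  refine ⟨?_, ?_, ?_, ?_⟩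
  · rw [weightOp_monomial, wt_uWt]; simp
  · rw [weightOp_monomial, wt_hrowWt]; simp
  · rw [weightOp_monomial, wt_hrowWt]; simp
  · rw [weightOp_monomial, wt_hwWt]; simp

/-- A monomial is harmonic iff it is a pure `z`-monomial or a pure power of `w`. -/
theorem isHarmonic_monomial_iff (n₁ n₂ e : ℕ) (c : ℂ) (hc : c ≠ 0) :
    IsHarmonic (monomial (expo n₁ n₂ e) c) ↔ e = 0 ∨ (n₁ = 0 ∧ n₂ = 0) := by
  classical
  rw [isHarmonic_iff_support]
  constructor
  · intro h
    have := h (expo n₁ n₂ e) (by rw [MvPolynomial.mem_support_iff, coeff_monomial, if_pos rfl]; exact hc)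
    simpa using this
  · intro h m hm
    rw [support_monomial, if_neg hc, Finset.mem_singleton] at hm
    subst hm
    simpa using h

/-- **Classification of the joint harmonic highest-weight vectors of `ℂ[z₁,z₂,w]`**: exactly the multiples of
`z₁^a` (`a ≥ 0`) and of `w^d` (`d ≥ 1`), with the displayed weights.  This is the content of [Ich22] Lemma 7.10 for
`(p,q;r,s) = (1,0;2,1)` read in the vacuum-normalised explicit model. -/
theorem isHWVector_iff (f : HarmModel) (k n₁ n₂ e : ℤ) :
    IsHWVector f k n₁ n₂ e ↔
      (∃ (a : ℕ) (c : ℂ), c ≠ 0 ∧ f = c • hz 0 ^ a ∧ k = a ∧ n₁ = a ∧ n₂ = 0 ∧ e = 0) ∨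
      (∃ (d : ℕ) (c : ℂ), 1 ≤ d ∧ c ≠ 0 ∧ f = c • hw ^ d ∧ k = -(d : ℤ) ∧ n₁ = 0 ∧ n₂ = 0 ∧ e = d) := by
  classical
  constructor
  · intro H
    obtain ⟨hn₁, hn₂, he, hf⟩ := eq_smul_monomial_of_weights H.row0 H.row1 H.wdeg H.ne
    set c := coeff (expo n₁.toNat n₂.toNat e.toNat) f with hc_def
    have hc : c ≠ 0 := by
      intro h0; apply H.ne; rw [hf, h0, zero_smul]
    have hfm : f = monomial (expo n₁.toNat n₂.toNat e.toNat) c := by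
      rw [hf, smul_monomial, smul_eq_mul, mul_one]
    -- `E₊ f = 0` forces `n₂ = 0`
    have hn₂0 : n₂.toNat = 0 := by
      have h := H.hw
      rw [hfm, hEplus_monomial_eq_zero_iff _ _ hc] at h
      simpa using h
    -- harmonicity forces `e = 0` or `n₁ = n₂ = 0`
    have hharm : e.toNat = 0 ∨ (n₁.toNat = 0 ∧ n₂.toNat = 0) := by
      have h := H.harm
      rw [hfm, isHarmonic_monomial_iff _ _ _ _ hc] at h
      exact h
    -- the `U(W)`-weight is `n₁ + n₂ − e`
    have hk : k = n₁ + n₂ - e := by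
      have h := H.uW
      rw [hfm, (weightOp_monomial_expo _ _ _ c).1] at h
      have hmon : (monomial (expo n₁.toNat n₂.toNat e.toNat) c : HarmModel) ≠ 0 := by
        rw [Ne, monomial_eq_zero]; exact hc
      have := smul_left_injective ℂ hmon h
      have h' : ((n₁.toNat : ℤ) + n₂.toNat - e.toNat : ℤ) = k := by exact_mod_cast this
      omega
    rcases hharm with he0 | ⟨hn₁0, -⟩
    · left
      refine ⟨n₁.toNat, c, hc, ?_, by omega, by omega, by omega, by omega⟩
      rw [hfm, hz0_pow_eq, smul_monomial, smul_eq_mul, mul_one, hn₂0, he0]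
    · by_cases he0 : e.toNat = 0
      · left
        refine ⟨0, c, hc, ?_, by omega, by omega, by omega, by omega⟩
        rw [hfm, hz0_pow_eq, smul_monomial, smul_eq_mul, mul_one, hn₁0, hn₂0, he0]
      · right
        refine ⟨e.toNat, c, Nat.one_le_iff_ne_zero.mpr he0, hc, ?_, by omega, by omega, by omega, by omega⟩
        rw [hfm, hw_pow_eq, smul_monomial, smul_eq_mul, mul_one, hn₁0, hn₂0]
  · rintro (⟨a, c, hc, rfl, rfl, rfl, rfl, rfl⟩ | ⟨d, c, hd, hc, rfl, rfl, rfl, rfl, rfl⟩)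
    · have hm : c • hz 0 ^ a = monomial (expo a 0 0) c := by
        rw [hz0_pow_eq, smul_monomial, smul_eq_mul, mul_one]
      obtain ⟨w1, w2, w3, w4⟩ := weightOp_monomial_expo a 0 0 c
      refine ⟨?_, ?_, ?_, ?_, ?_, ?_, ?_⟩
      · rw [hm, Ne, monomial_eq_zero]; exact hc
      · rw [hm, isHarmonic_monomial_iff _ _ _ _ hc]; exact Or.inl rfl
      · rw [hm, w1]; norm_num
      · rw [hm, w2]
      · rw [hm, w3]; norm_num
      · rw [hm, w4]; norm_num
      · rw [hm, hEplus_monomial_eq_zero_iff _ _ hc]; simp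
    · have hm : c • hw ^ d = monomial (expo 0 0 d) c := by
        rw [hw_pow_eq, smul_monomial, smul_eq_mul, mul_one]
      obtain ⟨w1, w2, w3, w4⟩ := weightOp_monomial_expo 0 0 d c
      refine ⟨?_, ?_, ?_, ?_, ?_, ?_, ?_⟩
      · rw [hm, Ne, monomial_eq_zero]; exact hc
      · rw [hm, isHarmonic_monomial_iff _ _ _ _ hc]; exact Or.inr ⟨rfl, rfl⟩
      · rw [hm, w1]; norm_num
      · rw [hm, w2]; norm_num
      · rw [hm, w3]; norm_num
      · rw [hm, w4]
      · rw [hm, hEplus_monomial_eq_zero_iff _ _ hc]; simp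

/-! ## §3 The `FockHarmonics` dictionary of the explicit model and Ichino's Lemma 7.10 as a THEOREM -/

section Dictionary

/-- **The joint-harmonics correspondence of the explicit model**, as an instance of the [Ich22] dictionary for a datum
`S` of signature `(p,q;r,s) = (1,0;2,1)`: `μ ⊠ μ′` occurs in `ℋ` iff there is a joint harmonic highest-weight vector
`f ∈ ℂ[z₁,z₂,w]` whose polynomial weights, SHIFTED by the printed vacuum weights `(r−s)/2 + m₀/2` (on `U(W)`) and
`((p−q)/2; (q−p)/2) + n₀/2` (on `K′ = U(2) × U(1)`; the `U(1)_V` acts by MINUS the `w`-degree), are `(μ; μ′)`. -/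
def explicitLine (S : SplittingDatum) (hr : S.r = 2) : FockHarmonics S where
  corresponds μ μ' := ∃ (f : HarmModel) (k n₁ n₂ e : ℤ), IsHWVector f k n₁ n₂ e ∧
    (∀ i, μ.1 i = (k : ℚ) + ((S.r : ℚ) - S.s) / 2 + (S.m₀ : ℚ) / 2) ∧
    μ'.1 ⟨0, by omega⟩ = (n₁ : ℚ) + ((S.p : ℚ) - S.q) / 2 + (S.n₀ : ℚ) / 2 ∧
    μ'.1 ⟨1, by omega⟩ = (n₂ : ℚ) + ((S.p : ℚ) - S.q) / 2 + (S.n₀ : ℚ) / 2 ∧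
    (∀ j, μ'.2 j = -(e : ℚ) + ((S.q : ℚ) - S.p) / 2 + (S.n₀ : ℚ) / 2)

/-- Unfolding lemma for `corresponds`. -/
theorem explicitLine_corresponds (S : SplittingDatum) (hr : S.r = 2) (μ : KWt S.p S.q) (μ' : KWt S.r S.s) :
    (explicitLine S hr).corresponds μ μ' ↔ ∃ (f : HarmModel) (k n₁ n₂ e : ℤ), IsHWVector f k n₁ n₂ e ∧
      (∀ i, μ.1 i = (k : ℚ) + ((S.r : ℚ) - S.s) / 2 + (S.m₀ : ℚ) / 2) ∧
      μ'.1 ⟨0, by omega⟩ = (n₁ : ℚ) + ((S.p : ℚ) - S.q) / 2 + (S.n₀ : ℚ) / 2 ∧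
      μ'.1 ⟨1, by omega⟩ = (n₂ : ℚ) + ((S.p : ℚ) - S.q) / 2 + (S.n₀ : ℚ) / 2 ∧
      (∀ j, μ'.2 j = -(e : ℚ) + ((S.q : ℚ) - S.p) / 2 + (S.n₀ : ℚ) / 2) :=
  Iff.rfl


-- port_pkg: scope closed for this part
end Dictionary
end IchinoExplicitLine
end Binders
end Model
end HodgeCM
end
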